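import Literature.Analysis.FluidPDE.NSBoundedHigherRegularity
import Literature.Analysis.FluidPDE.NSBoundedTimeHolderTop
import Literature.Analysis.Calculus.DerivativeInterpolation
import Literature.Analysis.FunctionSpaces.ContDiffOnLimit
import HarnessLib

/-!
# From smooth slices and local Hölder pieces to space–time Hölder spatial derivatives

Analysis/FluidPDE support file (theorems only; no definitions, no named facts), the
*pure-analysis last step* of the higher-regularity statement with constants
`NSBoundedHigherRegularityBounds` (Seregin–Šverák 2009, arXiv:0804.1803, §2 p. 8: "for any
natural `k`, `z = (x,t) ↦ ∇ᵏv(z)` is Hölder continuous in `Q̄₂` … The corresponding norms are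
estimated by constants depending on [the data]"). A bootstrap in the space variables (Serrin
1962; the tree's `NSBootstrap.level_zero` / `NSBootstrap.level_step`) produces, for almost every
time slice of a velocity field `u` on a cylinder `]a⁺, b⁺[ × B(x₀, ρ⁺)`, a smooth representative
with *a priori* bounds `‖D^k‖ ≤ D k` of all its derivatives; the time regularity through the
pressure (Robinson–Rodrigo–Sadowski 2016, §13.5; the tree's
`SliceTimeHolderQuant.exists_holderOnWith_representative_quant`) produces, on every small
centred sub-cylinder, a representative which is `(K₀, κ)`-Hölder in space–time with *a priori*
`K₀, κ`. This file proves that these two inputs alone already give the printed conclusion, with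
constants fixed before `u` (`exists_rep_of_slices_of_pieces`): one representative `V` on the
inner cylinder `]a, b[ × B(x₀, ρ)`, continuous in space–time, **every** slice of which is `C^∞`
with `‖D_xⁿ V‖ ≤ D n`, and whose spatial derivatives of every order are Hölder continuous in
space–time (sup product metric) with explicit constants.

Mechanism (Landau 1913 / Kolmogorov interpolation; Dieudonné (8.6.3)–(8.6.4)):

* `norm_iteratedFDeriv_succ_le_of_bounds_on`, `exists_landau_iterate` — Landau's inequality
  `‖D^{k+1}f(p)‖ ≤ 2 sup‖D^k f‖/s + s sup‖D^{k+2}f‖` on balls for functions smooth on an open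
  ball (the tree's `Literature.Analysis.Calculus.norm_iteratedFDeriv_succ_le_of_bounds`,
  localised), iterated with the optimal `s ∼ ε^{1/2^{k+1}}`: smallness `‖f‖ ≤ A ε` of order zero
  and bounds of all orders give `‖D^k f‖ ≤ E_k ε^{1/2^k}` on a smaller ball, `E_k` explicit;
* the local `(K₀, κ)`-Hölder pieces patch to one continuous representative `V` (continuous
  representatives agree on open overlaps, `Measure.eqOn_open_of_ae_eq`), which on almost every
  slice *is* the smooth slice representative; applied to the difference of two good slices,
  the interpolation gives the modulus `‖D_xⁿV(t, ·) - D_xⁿV(t', ·)‖ ≤ E_n |t - t'|^{κ/2ⁿ}`;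
* every slice (not only almost every one) is then the `C^∞`-limit of good slices
  (`Literature.Analysis.FunctionSpaces.contDiffOn_infty_of_uniformCauchySeqOn_iteratedFDeriv`),
  so the bounds and the modulus hold everywhere, and with the spatial Lipschitz bound from
  `D (n+1)` they combine to a Hölder bound for the sup product metric of `ℝ × ℝ³`.

Everything is stated for fields `ℝ → ℝ³ → ℝ³` on product cylinders `]a, b[ × B(x₀, ρ)` (the
format of `parabolicCylinder`), with no reference to any equation.

## References

* G. Seregin, V. Šverák, Comm. PDE 34 (2009) 171–201 = arXiv:0804.1803, §2 p. 8.
  [`SereginSverak2009`]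
* E. Landau, Proc. LMS 13 (1913) 43–49; J. Dieudonné, *Foundations of Modern Analysis* (1960),
  (8.6.3)–(8.6.4). [folklore]
* J. C. Robinson, J. L. Rodrigo, W. Sadowski, *The Three-Dimensional Navier–Stokes Equations*
  (CUP 2016), §13.5. [`RobinsonRodrigoSadowskiCUP2016`]
-/

noncomputable section

open MeasureTheory Set Function Filter Topology TopologicalSpace Metric
open scoped NNReal ContDiff

namespace Literature.Analysis.FluidPDE

namespace STAssembly

/-! ### Landau's inequality on balls for functions smooth on an open ball, iterated -/

section Landau

variable {P : Type*} [NormedAddCommGroup P] [NormedSpace ℝ P]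
variable {G : Type*} [NormedAddCommGroup G] [NormedSpace ℝ G]

/-- Natural numbers are finite smoothness exponents. [folklore] -/
theorem natCast_lt_infty (m : ℕ) : (m : ℕ∞ω) < ∞ := by
  exact_mod_cast WithTop.coe_lt_coe.2 (ENat.coe_lt_top m)

/-- **Landau's inequality between consecutive orders, local form.** For `f` smooth on an open
set `U ⊇ ball p r`, if `‖Dᵏ f‖ ≤ M₀` and `‖Dᵏ⁺² f‖ ≤ M₂` on `ball p r`, then
`‖Dᵏ⁺¹ f (p)‖ ≤ 2 M₀ / s + s M₂` for every `0 < s < r` (the tree's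
`Calculus.norm_iteratedFDeriv_succ_le_of_bounds` asks for `f` smooth everywhere; same proof).
[folklore] -/
theorem norm_iteratedFDeriv_succ_le_of_bounds_on {f : P → G} {U : Set P} (hU : IsOpen U)
    (hf : ContDiffOn ℝ (∞ : ℕ∞ω) f U) {p : P} {r M₀ M₂ : ℝ} (hM₂ : 0 ≤ M₂) (hr : ball p r ⊆ U) {k : ℕ}
    (h0 : ∀ y ∈ ball p r, ‖iteratedFDeriv ℝ k f y‖ ≤ M₀)
    (h2 : ∀ y ∈ ball p r, ‖iteratedFDeriv ℝ (k + 2) f y‖ ≤ M₂) {s : ℝ} (hs : 0 < s)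
    (hsr : s < r) : ‖iteratedFDeriv ℝ (k + 1) f p‖ ≤ 2 * M₀ / s + s * M₂ := by
  have hdiff : ∀ (m : ℕ), ∀ y ∈ ball p r, DifferentiableAt ℝ (iteratedFDeriv ℝ m f) y :=
    fun m y hy => (hf.contDiffAt (hU.mem_nhds (hr hy))).differentiableAt_iteratedFDeriv
      (natCast_lt_infty m)
  rw [← norm_fderiv_iteratedFDeriv]
  refine Calculus.norm_fderiv_le_of_norm_le_of_lipschitz (hdiff k) h0 hM₂ (fun y hy => ?_) hs hsr
  rw [Calculus.fderiv_iteratedFDeriv_apply_eq_curry, Calculus.fderiv_iteratedFDeriv_apply_eq_curry,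
    ← LinearIsometryEquiv.map_sub, LinearIsometryEquiv.norm_map]
  have hr0 : 0 < r := hs.trans hsr
  refine (convex_ball p r).norm_image_sub_le_of_norm_fderiv_le (fun z hz => hdiff (k + 1) z hz)
    (fun z hz => ?_) (mem_ball_self hr0) hy
  rw [norm_fderiv_iteratedFDeriv]
  exact h2 z hz

/-- **Landau's inequality iterated, with the constants displayed.** Given `A ≥ 0`, a margin
`m > 0` and bounds `B k ≥ 0` there are constants `E k ≥ 0` (`E 0 = A`,
`E (k+1) = 2^{k+3} E k / m + m B (k+2) / 2^{k+2}`) such that: whenever `f` is smooth on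
`ball x₀ ρ₁` with `‖Dᵏ f‖ ≤ B k` there for all `k`, and `‖f‖ ≤ A ε` there for some `0 < ε ≤ 1`,
then `‖Dᵏ f‖ ≤ E k · ε^{(1/2)ᵏ}` on `ball x₀ (ρ₁ - m)` for every `k` (Landau between the orders
`k, k+1, k+2` on balls of radius `m/2^{k+1}` with `s = (m/2^{k+2}) ε^{(1/2)^{k+1}}`).
[folklore] -/
theorem exists_landau_iterate (A m : ℝ) (hA : 0 ≤ A) (hm : 0 < m) (B : ℕ → ℝ)
    (hB : ∀ k, 0 ≤ B k) :
    ∃ E : ℕ → ℝ, (∀ k, 0 ≤ E k) ∧ E 0 = A ∧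
      ∀ (f : P → G) (x₀ : P) (ρ₁ : ℝ), ContDiffOn ℝ (∞ : ℕ∞ω) f (ball x₀ ρ₁) →
      (∀ k, ∀ y ∈ ball x₀ ρ₁, ‖iteratedFDeriv ℝ k f y‖ ≤ B k) →
      ∀ ε : ℝ, 0 < ε → ε ≤ 1 → (∀ y ∈ ball x₀ ρ₁, ‖f y‖ ≤ A * ε) →
      ∀ k, ∀ y ∈ ball x₀ (ρ₁ - m), ‖iteratedFDeriv ℝ k f y‖ ≤ E k * ε ^ ((1 / 2 : ℝ) ^ k) := by
  -- the constants
  let E : ℕ → ℝ := fun k =>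
    Nat.rec A (fun k Ek => 2 ^ (k + 3) * Ek / m + m * B (k + 2) / 2 ^ (k + 2)) k
  have hE0 : E 0 = A := rfl
  have hEs : ∀ k, E (k + 1) = 2 ^ (k + 3) * E k / m + m * B (k + 2) / 2 ^ (k + 2) := fun k => rfl
  have hEnn : ∀ k, 0 ≤ E k := by
    intro k
    induction k with
    | zero => rw [hE0]; exact hA
    | succ k ih => rw [hEs]; have := hB (k + 2); positivity
  refine ⟨E, hEnn, hE0, ?_⟩
  intro f x₀ ρ₁ hf hbd ε hε hε1 hsmall
  -- the claim on the shrinking balls `ball x₀ (ρ₁ - m + m / 2^k)`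
  have key : ∀ k, ∀ y ∈ ball x₀ (ρ₁ - m + m / 2 ^ k),
      ‖iteratedFDeriv ℝ k f y‖ ≤ E k * ε ^ ((1 / 2 : ℝ) ^ k) := by
    intro k
    induction k with
    | zero =>
      intro y hy
      rw [norm_iteratedFDeriv_zero, hE0, pow_zero, Real.rpow_one]
      refine hsmall y ?_
      have : ρ₁ - m + m / 2 ^ 0 = ρ₁ := by rw [pow_zero, div_one, sub_add_cancel]
      rwa [this] at hy
    | succ k ih =>
      intro y hy
      -- the ball of radius `m / 2^{k+1}` around `y` lies in the previous ball
      set r' : ℝ := m / 2 ^ (k + 1) with hr'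
      have hr'0 : 0 < r' := by positivity
      have hhalf' : m / 2 ^ (k + 1) + m / 2 ^ (k + 1) = m / 2 ^ k := by
        rw [pow_succ]; field_simp; ring
      have hsub : ball y r' ⊆ ball x₀ (ρ₁ - m + m / 2 ^ k) := by
        intro z hz
        rw [mem_ball] at hy hz ⊢
        have := dist_triangle z y x₀
        linarith
      have hsub₁ : ball y r' ⊆ ball x₀ ρ₁ := by
        refine hsub.trans (ball_subset_ball ?_)
        have : m / 2 ^ k ≤ m := div_le_self hm.le (one_le_pow₀ (by norm_num))
        linarith
      -- the exponents
      have hhalf : (1 / 2 : ℝ) ^ (k + 1) + (1 / 2 : ℝ) ^ (k + 1) = (1 / 2 : ℝ) ^ k := by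
        rw [pow_succ]; ring
      set e₁ : ℝ := ε ^ ((1 / 2 : ℝ) ^ (k + 1)) with he₁
      have he₁0 : 0 < e₁ := Real.rpow_pos_of_pos hε _
      have he₁1 : e₁ ≤ 1 := Real.rpow_le_one hε.le hε1 (by positivity)
      have hsplit : ε ^ ((1 / 2 : ℝ) ^ k) = e₁ * e₁ := by
        rw [he₁, ← Real.rpow_add hε, hhalf]
      have ih' : ∀ z ∈ ball y r', ‖iteratedFDeriv ℝ k f z‖ ≤ E k * (e₁ * e₁) := fun z hz => by
        rw [← hsplit]; exact ih z (hsub hz)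
      -- Landau with `s = (m / 2^{k+2}) e₁`
      set s : ℝ := m / 2 ^ (k + 2) * e₁ with hsdef
      have hs0 : 0 < s := by positivity
      have hsr : s < r' := by
        rw [hsdef, hr']
        have h1 : m / 2 ^ (k + 2) * e₁ ≤ m / 2 ^ (k + 2) :=
          mul_le_of_le_one_right (by positivity) he₁1
        have h2 : m / 2 ^ (k + 2) < m / 2 ^ (k + 1) :=
          div_lt_div_of_pos_left hm (by positivity) (pow_lt_pow_right₀ one_lt_two (by omega))
        exact h1.trans_lt h2
      have hL := norm_iteratedFDeriv_succ_le_of_bounds_on isOpen_ball hf (hB (k + 2)) hsub₁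
        ih' (fun z hz => hbd (k + 2) z (hsub₁ hz)) hs0 hsr
      refine hL.trans (le_of_eq ?_)
      rw [hEs, hsdef]
      field_simp
      ring
  intro k y hy
  refine key k y (ball_subset_ball ?_ hy)
  have : 0 ≤ m / 2 ^ k := by positivity
  linarith

end Landau

/-! ### Pieces in time: every two close times lie in a common admissible window -/

/-- **Admissible time windows.** If `2δ ≤ b⁺ - a⁺`, any two times `a⁺ < s₁ ≤ s₂ < b⁺` with
`s₂ - s₁ < δ` lie in a common window `]t' - δ, t' + δ[ ⊆ ]a⁺, b⁺[`. [folklore] -/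
theorem exists_time_window {ap bp δ s₁ s₂ : ℝ} (h2δ : 2 * δ ≤ bp - ap) (hs₁ : ap < s₁)
    (hs₂ : s₂ < bp) (h12 : s₁ ≤ s₂) (hd : s₂ - s₁ < δ) :
    ∃ t' : ℝ, Ioo (t' - δ) (t' + δ) ⊆ Ioo ap bp ∧ s₁ ∈ Ioo (t' - δ) (t' + δ) ∧
      s₂ ∈ Ioo (t' - δ) (t' + δ) := by
  by_cases h1 : s₁ ≤ ap + δ
  · refine ⟨ap + δ, Ioo_subset_Ioo (by linarith) (by linarith), ⟨by linarith, by linarith⟩,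
      ⟨by linarith, by linarith⟩⟩
  by_cases h2 : s₁ + δ ≤ bp
  · refine ⟨s₁, Ioo_subset_Ioo (by linarith) h2, ⟨by linarith, by linarith⟩,
      ⟨by linarith, by linarith⟩⟩
  · refine ⟨bp - δ, Ioo_subset_Ioo (by linarith) (by linarith), ⟨by linarith, by linarith⟩,
      ⟨by linarith, by linarith⟩⟩

/-! ### Two elementary `rpow` inequalities -/

/-- `d ≤ Δ · d^{κ'}` for `0 ≤ d ≤ Δ`, `1 ≤ Δ`, `0 < κ' ≤ 1`. [folklore] -/
theorem le_mul_rpow_of_le {d Δ κ' : ℝ} (hd : 0 ≤ d) (hdΔ : d ≤ Δ) (hΔ : 1 ≤ Δ) (hκ' : 0 < κ')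
    (hκ'1 : κ' ≤ 1) : d ≤ Δ * d ^ κ' := by
  rcases hd.eq_or_lt with h | hd0
  · rw [← h, Real.zero_rpow hκ'.ne', mul_zero]
  have h1 : d = d ^ (1 - κ') * d ^ κ' := by
    rw [← Real.rpow_add hd0, sub_add_cancel, Real.rpow_one]
  have h2 : d ^ (1 - κ') ≤ Δ ^ (1 - κ') := Real.rpow_le_rpow hd hdΔ (by linarith)
  have h3 : Δ ^ (1 - κ') ≤ Δ := by
    conv_rhs => rw [← Real.rpow_one Δ]
    exact Real.rpow_le_rpow_of_exponent_le hΔ (by linarith)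
  have h4 : 0 ≤ d ^ κ' := Real.rpow_nonneg hd _
  calc d = d ^ (1 - κ') * d ^ κ' := h1
    _ ≤ Δ * d ^ κ' := mul_le_mul_of_nonneg_right (h2.trans h3) h4

/-- `δ' ≤ d^{κ'}` for `0 < δ' ≤ min d 1`, `0 < κ' ≤ 1`. [folklore] -/
theorem le_rpow_of_le_of_le_one {d δ' κ' : ℝ} (hδ'1 : δ' ≤ 1) (hδ'd : δ' ≤ d) (hδ'0 : 0 < δ')
    (hκ' : 0 < κ') (hκ'1 : κ' ≤ 1) : δ' ≤ d ^ κ' := by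
  have hd0 : 0 < d := hδ'0.trans_le hδ'd
  rcases le_or_gt d 1 with hd1 | hd1
  · calc δ' ≤ d := hδ'd
      _ = d ^ (1 : ℝ) := (Real.rpow_one d).symm
      _ ≤ d ^ κ' := Real.rpow_le_rpow_of_exponent_ge hd0 hd1 hκ'1
  · exact hδ'1.trans (Real.one_le_rpow hd1.le hκ'.le)

/-! ### The assembly -/

section Main

/-- **From smooth slices with a priori bounds and local Hölder pieces with a priori constants to
one representative with space–time Hölder spatial derivatives of all orders, constants fixed
before the field.** Data: times `a⁺ ≤ a`, `b ≤ b⁺` and a window half-width `δ > 0` with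
`2δ ≤ b⁺ - a⁺`; radii `ρ < ρ₁`, `ρ₁ + η⁺ ≤ ρ⁺`, piece radii `0 < η ≤ η⁺`; Hölder data
`K₀`, `0 < κ ≤ 1`; derivative bounds `D k ≥ 0`. Then there are `C n`, `α n > 0` (`α n = κ/2ⁿ`)
such that for every field `u : ℝ → EuclideanSpace ℝ (Fin 3) → EuclideanSpace ℝ (Fin 3)` with
(A) for every window `]t' - δ, t' + δ[ ⊆ ]a⁺, b⁺[` and centre `x'` with `B(x', η⁺) ⊆ B(x₀, ρ⁺)`
    a function `W`, `(K₀, κ)`-Hölder on `]t' - δ, t' + δ[ × B(x', η)` (sup product metric),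
    with `u = W` a.e. there, and
(B) for a.e. `t ∈ ]a⁺, b⁺[` a function `v`, `C^∞` on `B(x₀, ρ⁺)` with `‖Dᵏv‖ ≤ D k` there for
    all `k`, with `u(t, ·) = v` a.e. on `B(x₀, ρ⁺)`,
there is `V : ℝ → EuclideanSpace ℝ (Fin 3) → EuclideanSpace ℝ (Fin 3)` with `u = V` a.e. on `Q = ]a, b[ × B(x₀, ρ)`, `uncurry V` continuous
on `Q`, every slice `V t` (`t ∈ ]a, b[`) `C^∞` on `B(x₀, ρ)` with `‖DⁿV t‖ ≤ D n`, and
`(t, x) ↦ D_xⁿ V(t, x)` `(C n, α n)`-Hölder on `Q` for every `n`. Proof: module docstring.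
[cite: SereginSverak2009, §2 p. 8 (the statement being assembled); mechanism folklore (Landau 1913; Dieudonné (8.6.3)–(8.6.4))] -/
theorem exists_rep_of_slices_of_pieces (ap bp a b : ℝ) (x₀ : EuclideanSpace ℝ (Fin 3)) (ρ ρ₁ ρp δ η ηp : ℝ)
    (hapa : ap ≤ a) (hbbp : b ≤ bp) (hδ : 0 < δ) (h2δ : 2 * δ ≤ bp - ap)
    (hρρ₁ : ρ < ρ₁) (hρ₁ : ρ₁ + ηp ≤ ρp) (hη : 0 < η) (hηηp : η ≤ ηp) (K₀ κ : ℝ≥0) (hκ : 0 < κ)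
    (hκ1 : κ ≤ 1) (D : ℕ → ℝ) (hD : ∀ k, 0 ≤ D k) :
    ∃ C α : ℕ → ℝ≥0, (∀ n, 0 < α n) ∧
      ∀ u : ℝ → EuclideanSpace ℝ (Fin 3) → EuclideanSpace ℝ (Fin 3),
        (∀ (t' : ℝ) (x' : EuclideanSpace ℝ (Fin 3)), Ioo (t' - δ) (t' + δ) ⊆ Ioo ap bp → ball x' ηp ⊆ ball x₀ ρp →
          ∃ W : ℝ × EuclideanSpace ℝ (Fin 3) → EuclideanSpace ℝ (Fin 3), HolderOnWith K₀ κ W (Ioo (t' - δ) (t' + δ) ×ˢ ball x' η) ∧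
            uncurry u =ᵐ[volume.restrict (Ioo (t' - δ) (t' + δ) ×ˢ ball x' η)] W) →
        (∀ᵐ t ∂(volume.restrict (Ioo ap bp)), ∃ v : EuclideanSpace ℝ (Fin 3) → EuclideanSpace ℝ (Fin 3),
          ContDiffOn ℝ (∞ : ℕ∞ω) v (ball x₀ ρp) ∧
          (∀ k, ∀ y ∈ ball x₀ ρp, ‖iteratedFDeriv ℝ k v y‖ ≤ D k) ∧
          u t =ᵐ[volume.restrict (ball x₀ ρp)] v) →
        ∃ V : ℝ → EuclideanSpace ℝ (Fin 3) → EuclideanSpace ℝ (Fin 3),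
          uncurry u =ᵐ[volume.restrict (Ioo a b ×ˢ ball x₀ ρ)] uncurry V ∧
          ContinuousOn (uncurry V) (Ioo a b ×ˢ ball x₀ ρ) ∧
          (∀ t ∈ Ioo a b, ContDiffOn ℝ (∞ : ℕ∞ω) (V t) (ball x₀ ρ)) ∧
          (∀ n, ∀ w ∈ Ioo a b ×ˢ ball x₀ ρ, ‖iteratedFDeriv ℝ n (V w.1) w.2‖ ≤ D n) ∧
          ∀ n, HolderOnWith (C n) (α n) (fun w : ℝ × EuclideanSpace ℝ (Fin 3) => iteratedFDeriv ℝ n (V w.1) w.2)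
            (Ioo a b ×ˢ ball x₀ ρ) := by
  /- ── the constants ── -/
  have hηp : 0 < ηp := hη.trans_le hηηp
  have hρ₁ρp : ρ₁ < ρp := by linarith
  set m : ℝ := ρ₁ - ρ with hm
  have hm0 : 0 < m := by rw [hm]; linarith
  obtain ⟨E, hE0, -, hLandau⟩ := exists_landau_iterate (P := EuclideanSpace ℝ (Fin 3)) (G := EuclideanSpace ℝ (Fin 3)) (K₀ : ℝ) m
    K₀.coe_nonneg hm0 (fun k => 2 * D k) (fun k => by have := hD k; positivity)
  set δ' : ℝ := min δ 1 with hδ'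
  have hδ'0 : 0 < δ' := lt_min hδ one_pos
  have hδ'1 : δ' ≤ 1 := min_le_right _ _
  have hδ'δ : δ' ≤ δ := min_le_left _ _
  set Δ : ℝ := max 1 (max (bp - ap) (2 * ρp)) with hΔ
  have hΔ1 : 1 ≤ Δ := le_max_left _ _
  -- the exponents `κ_n = κ / 2ⁿ`
  set κr : ℕ → ℝ := fun n => (κ : ℝ) * (1 / 2 : ℝ) ^ n with hκr
  have hκr0 : ∀ n, 0 < κr n := fun n => by
    simp only [hκr]
    have : (0 : ℝ) < κ := by exact_mod_cast hκ
    positivity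
  have hκr1 : ∀ n, κr n ≤ 1 := fun n => by
    simp only [hκr]
    have h1 : (κ : ℝ) ≤ 1 := by exact_mod_cast hκ1
    have h2 : (1 / 2 : ℝ) ^ n ≤ 1 := pow_le_one₀ (by norm_num) (by norm_num)
    have h3 : (0 : ℝ) ≤ (1 / 2 : ℝ) ^ n := by positivity
    nlinarith [κ.coe_nonneg]
  set αn : ℕ → ℝ≥0 := fun n => κ * (1 / 2 : ℝ≥0) ^ n with hαn
  have hαnκ : ∀ n, ((αn n : ℝ≥0) : ℝ) = κr n := fun n => by
    simp only [hαn, hκr]; push_cast; ring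
  have hαn0 : ∀ n, 0 < αn n := fun n => by
    rw [← NNReal.coe_pos, hαnκ]; exact hκr0 n
  set Cr : ℕ → ℝ := fun n => D (n + 1) * Δ + E n + 2 * D n / δ' with hCr
  have hCr0 : ∀ n, 0 ≤ Cr n := fun n => by
    simp only [hCr]; have := hD n; have := hD (n + 1); have := hE0 n; positivity
  refine ⟨fun n => (Cr n).toNNReal, αn, hαn0, ?_⟩
  intro u hA hB
  /- ── Step 1: one continuous representative on `Q₁ = ]a⁺, b⁺[ × B(x₀, ρ₁)` ── -/
  set Q₁ : Set (ℝ × EuclideanSpace ℝ (Fin 3)) := Ioo ap bp ×ˢ ball x₀ ρ₁ with hQ₁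
  have hQ₁o : IsOpen Q₁ := isOpen_Ioo.prod isOpen_ball
  -- admissible windows around every time of `]a⁺, b⁺[`
  have hwin : ∀ s ∈ Ioo ap bp, ∃ t' : ℝ, Ioo (t' - δ) (t' + δ) ⊆ Ioo ap bp ∧
      s ∈ Ioo (t' - δ) (t' + δ) := by
    intro s hs
    obtain ⟨t', h1, h2, -⟩ := exists_time_window h2δ hs.1 hs.2 le_rfl (by simp [hδ])
    exact ⟨t', h1, h2⟩
  -- pieces centred at points of `Q₁` are admissible
  have hballp : ∀ y ∈ ball x₀ ρ₁, ball y ηp ⊆ ball x₀ ρp := by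
    intro y hy z hz
    rw [mem_ball] at hy hz ⊢
    linarith [dist_triangle z y x₀]
  set piece : ℝ → EuclideanSpace ℝ (Fin 3) → Set (ℝ × EuclideanSpace ℝ (Fin 3)) := fun t' x' => Ioo (t' - δ) (t' + δ) ×ˢ ball x' η
    with hpiece
  have hpo : ∀ t' x', IsOpen (piece t' x') := fun t' x' => isOpen_Ioo.prod isOpen_ball
  obtain ⟨V₀, hV₀c, huV₀⟩ : ∃ V₀ : ℝ × EuclideanSpace ℝ (Fin 3) → EuclideanSpace ℝ (Fin 3), ContinuousOn V₀ Q₁ ∧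
      uncurry u =ᵐ[volume.restrict Q₁] V₀ := by
    refine exists_continuousOn_ae_eq_of_locally (μ := volume) fun w hw => ?_
    obtain ⟨hw1, hw2⟩ := mem_prod.1 hw
    obtain ⟨t', ht'I, hst'⟩ := hwin w.1 hw1
    obtain ⟨W, hWH, hWae⟩ := hA t' w.2 ht'I (hballp w.2 hw2)
    refine ⟨piece t' w.2 ∩ Q₁, (hpo t' w.2).inter hQ₁o, ⟨?_, hw⟩, inter_subset_right, W,
      (hWH.continuousOn hκ).mono inter_subset_left,
      ae_restrict_of_ae_restrict_of_subset inter_subset_left hWae⟩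
    exact mem_prod.2 ⟨hst', mem_ball_self hη⟩
  -- `V₀` agrees with every admissible piece representative on (piece ∩ Q₁)
  have hagree : ∀ (t' : ℝ) (x' : EuclideanSpace ℝ (Fin 3)) (W : ℝ × EuclideanSpace ℝ (Fin 3) → EuclideanSpace ℝ (Fin 3)),
      HolderOnWith K₀ κ W (piece t' x') →
      uncurry u =ᵐ[volume.restrict (piece t' x')] W → EqOn V₀ W (piece t' x' ∩ Q₁) := by
    intro t' x' W hWH hWae
    have hu1 : uncurry u =ᵐ[volume.restrict (piece t' x' ∩ Q₁)] V₀ :=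
      ae_restrict_of_ae_restrict_of_subset inter_subset_right huV₀
    have hu2 : uncurry u =ᵐ[volume.restrict (piece t' x' ∩ Q₁)] W :=
      ae_restrict_of_ae_restrict_of_subset inter_subset_left hWae
    have h1 : V₀ =ᵐ[volume.restrict (piece t' x' ∩ Q₁)] W := hu1.symm.trans hu2
    exact Measure.eqOn_open_of_ae_eq h1 ((hpo t' x').inter hQ₁o) (hV₀c.mono inter_subset_right)
      ((hWH.continuousOn hκ).mono inter_subset_left)
  -- the local Hölder modulus of `V₀`
  have hmod₀ : ∀ w₁ ∈ Q₁, ∀ w₂ ∈ Q₁, dist w₁.1 w₂.1 < δ → dist w₁.2 w₂.2 < η →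
      ‖V₀ w₁ - V₀ w₂‖ ≤ K₀ * dist w₁ w₂ ^ (κ : ℝ) := by
    -- ordered times first
    have key : ∀ w₁ ∈ Q₁, ∀ w₂ ∈ Q₁, w₁.1 ≤ w₂.1 → dist w₁.1 w₂.1 < δ → dist w₁.2 w₂.2 < η →
        ‖V₀ w₁ - V₀ w₂‖ ≤ K₀ * dist w₁ w₂ ^ (κ : ℝ) := by
      intro w₁ hw₁ w₂ hw₂ hle hdt hdx
      obtain ⟨hw₁1, hw₁2⟩ := mem_prod.1 hw₁
      obtain ⟨hw₂1, hw₂2⟩ := mem_prod.1 hw₂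
      have hd' : w₂.1 - w₁.1 < δ := by
        rw [Real.dist_eq, abs_sub_comm, abs_of_nonneg (sub_nonneg.2 hle)] at hdt
        exact hdt
      obtain ⟨t', ht'I, h1, h2⟩ := exists_time_window h2δ hw₁1.1 hw₂1.2 hle hd'
      obtain ⟨W, hWH, hWae⟩ := hA t' w₁.2 ht'I (hballp w₁.2 hw₁2)
      have hm₁ : w₁ ∈ piece t' w₁.2 := mem_prod.2 ⟨h1, mem_ball_self hη⟩
      have hm₂ : w₂ ∈ piece t' w₁.2 := mem_prod.2 ⟨h2, by rwa [mem_ball, dist_comm]⟩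
      rw [hagree t' w₁.2 W hWH hWae ⟨hm₁, hw₁⟩, hagree t' w₁.2 W hWH hWae ⟨hm₂, hw₂⟩,
        ← dist_eq_norm]
      exact hWH.dist_le hm₁ hm₂
    intro w₁ hw₁ w₂ hw₂ hdt hdx
    rcases le_total w₁.1 w₂.1 with hle | hle
    · exact key w₁ hw₁ w₂ hw₂ hle hdt hdx
    · rw [norm_sub_rev, dist_comm]
      rw [dist_comm] at hdt hdx
      exact key w₂ hw₂ w₁ hw₁ hle hdt hdx
  /- ── Step 2: good slices ── -/
  set V : ℝ → EuclideanSpace ℝ (Fin 3) → EuclideanSpace ℝ (Fin 3) := fun t y => V₀ (t, y) with hV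
  have hVsl : ∀ t ∈ Ioo ap bp, ContinuousOn (V t) (ball x₀ ρ₁) := by
    intro t ht
    refine hV₀c.comp (Continuous.prodMk_right t).continuousOn fun y hy => ?_
    exact mem_prod.2 ⟨ht, hy⟩
  -- Fubini: a.e. slice of `u` agrees a.e. with the slice of `V₀`
  have hfub : ∀ᵐ t ∂(volume.restrict (Ioo ap bp)),
      ∀ᵐ y ∂(volume.restrict (ball x₀ ρ₁)), u t y = V t y := by
    have h1 : ∀ᵐ w ∂((volume.restrict (Ioo ap bp)).prod (volume.restrict (ball x₀ ρ₁))),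
        uncurry u w = V₀ w := by
      rw [Measure.prod_restrict, ← Measure.volume_eq_prod]
      exact huV₀
    exact Measure.ae_ae_of_ae_prod h1
  -- the good times: smooth slice with the a priori bounds, on `B(x₀, ρ₁)`
  set Good : ℝ → Prop := fun t => t ∈ Ioo ap bp ∧ ContDiffOn ℝ (∞ : ℕ∞ω) (V t) (ball x₀ ρ₁) ∧
    ∀ k, ∀ y ∈ ball x₀ ρ₁, ‖iteratedFDeriv ℝ k (V t) y‖ ≤ D k with hGood
  have hGae : ∀ᵐ t ∂(volume.restrict (Ioo ap bp)), Good t := by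
    filter_upwards [hB, hfub, ae_restrict_mem measurableSet_Ioo] with t ht hft htI
    obtain ⟨v, hvs, hvb, huv⟩ := ht
    -- `v = V t` on `B(x₀, ρ₁)`
    have hsub : ball x₀ ρ₁ ⊆ ball x₀ ρp := ball_subset_ball hρ₁ρp.le
    have h1 : v =ᵐ[volume.restrict (ball x₀ ρ₁)] V t := by
      have h2 : u t =ᵐ[volume.restrict (ball x₀ ρ₁)] v :=
        ae_restrict_of_ae_restrict_of_subset hsub huv
      exact h2.symm.trans hft
    have heq : EqOn v (V t) (ball x₀ ρ₁) :=
      Measure.eqOn_open_of_ae_eq h1 isOpen_ball ((hvs.continuousOn).mono hsub) (hVsl t htI)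
    refine ⟨htI, (hvs.mono hsub).congr fun y hy => (heq hy).symm, fun k y hy => ?_⟩
    have hev : V t =ᶠ[𝓝 y] v := by
      filter_upwards [isOpen_ball.mem_nhds hy] with z hz using (heq hz).symm
    rw [(hev.iteratedFDeriv ℝ k).eq_of_nhds]
    exact hvb k y (hsub hy)
  /- ── Step 3: the time modulus of all derivatives between good slices, on `B(x₀, ρ)` ── -/
  have hρm : ρ₁ - m = ρ := by rw [hm]; ring
  have hmod : ∀ n, ∀ t t', Good t → Good t' → dist t t' < δ' →
      ∀ y ∈ ball x₀ ρ, ‖iteratedFDeriv ℝ n (V t) y - iteratedFDeriv ℝ n (V t') y‖ ≤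
        E n * dist t t' ^ κr n := by
    intro n t t' hgt hgt' hdt y hy
    rcases eq_or_ne t t' with h | hne
    · subst h
      rw [sub_self, norm_zero]
      exact mul_nonneg (hE0 n) (Real.rpow_nonneg dist_nonneg _)
    obtain ⟨htI, hts, htb⟩ := hgt
    obtain ⟨ht'I, ht's, ht'b⟩ := hgt'
    have hh0 : 0 < dist t t' := dist_pos.2 hne
    have hh1 : dist t t' ≤ 1 := hdt.le.trans hδ'1
    -- the difference of the two slices
    set f : EuclideanSpace ℝ (Fin 3) → EuclideanSpace ℝ (Fin 3) := fun y => V t y - V t' y with hf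
    have hfs : ContDiffOn ℝ (∞ : ℕ∞ω) f (ball x₀ ρ₁) := hts.sub ht's
    have hfD : ∀ k, ∀ z ∈ ball x₀ ρ₁, iteratedFDeriv ℝ k f z =
        iteratedFDeriv ℝ k (V t) z - iteratedFDeriv ℝ k (V t') z := by
      intro k z hz
      have h1 : ContDiffAt ℝ k (V t) z :=
        ((hts.contDiffAt (isOpen_ball.mem_nhds hz)).of_le (by exact_mod_cast le_top))
      have h2 : ContDiffAt ℝ k (V t') z :=
        ((ht's.contDiffAt (isOpen_ball.mem_nhds hz)).of_le (by exact_mod_cast le_top))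
      exact iteratedFDeriv_sub_apply h1 h2
    have hfb : ∀ k, ∀ z ∈ ball x₀ ρ₁, ‖iteratedFDeriv ℝ k f z‖ ≤ 2 * D k := by
      intro k z hz
      rw [hfD k z hz]
      exact (norm_sub_le _ _).trans (by linarith [htb k z hz, ht'b k z hz])
    -- smallness of order zero from the Hölder modulus of `V₀`
    set ε : ℝ := dist t t' ^ (κ : ℝ) with hε
    have hε0 : 0 < ε := Real.rpow_pos_of_pos hh0 _
    have hε1 : ε ≤ 1 := Real.rpow_le_one dist_nonneg hh1 κ.coe_nonneg
    have hf0 : ∀ z ∈ ball x₀ ρ₁, ‖f z‖ ≤ K₀ * ε := by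
      intro z hz
      have h1 := hmod₀ (t, z) (mem_prod.2 ⟨htI, hz⟩) (t', z) (mem_prod.2 ⟨ht'I, hz⟩)
        (hdt.trans_le hδ'δ) (by simp [hη])
      have h2 : dist ((t, z) : ℝ × EuclideanSpace ℝ (Fin 3)) (t', z) = dist t t' := by
        rw [Prod.dist_eq, dist_self, max_eq_left dist_nonneg]
      rw [h2] at h1
      exact h1
    have hL := hLandau f x₀ ρ₁ hfs hfb ε hε0 hε1 hf0 n y (by rwa [hρm])
    rw [hfD n y (ball_subset_ball hρρ₁.le hy), hε, ← Real.rpow_mul dist_nonneg] at hL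
    exact hL
  /- ── Step 4: every slice is a `C^∞` limit of good slices ── -/
  have hQsub : Ioo a b ×ˢ ball x₀ ρ ⊆ Q₁ :=
    prod_mono (Ioo_subset_Ioo hapa hbbp) (ball_subset_ball hρρ₁.le)
  have hIsub : Ioo a b ⊆ Ioo ap bp := Ioo_subset_Ioo hapa hbbp
  -- good times are dense
  have hdense : ∀ t₀ ∈ Ioo ap bp, ∃ ts : ℕ → ℝ, (∀ j, Good (ts j)) ∧
      Tendsto ts atTop (𝓝 t₀) := by
    intro t₀ ht₀
    have h1 : ∀ᵐ t ∂(volume : Measure ℝ), t ∈ Ioo ap bp → Good t :=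
      (ae_restrict_iff' measurableSet_Ioo).1 hGae
    have h2 : Dense {t : ℝ | t ∈ Ioo ap bp → Good t} := Measure.dense_of_ae h1
    have h3 : t₀ ∈ closure {t : ℝ | Good t} := by
      have h4 := h2.open_subset_closure_inter isOpen_Ioo ht₀
      refine closure_mono (fun t ht => ?_) h4
      exact ht.2 ht.1
    obtain ⟨ts, hts, hlim⟩ := mem_closure_iff_seq_limit.1 h3
    exact ⟨ts, hts, hlim⟩
  -- pointwise convergence of slices along any sequence of times, from the continuity of `V₀`
  have hptw : ∀ t₀ ∈ Ioo ap bp, ∀ (ts : ℕ → ℝ), Tendsto ts atTop (𝓝 t₀) →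
      ∀ y ∈ ball x₀ ρ₁, Tendsto (fun j => V (ts j) y) atTop (𝓝 (V t₀ y)) := by
    intro t₀ ht₀ ts hts y hy
    have hc : ContinuousAt V₀ (t₀, y) :=
      hV₀c.continuousAt (hQ₁o.mem_nhds (mem_prod.2 ⟨ht₀, hy⟩))
    have h2 : Tendsto (fun j => ((ts j, y) : ℝ × EuclideanSpace ℝ (Fin 3))) atTop (𝓝 (t₀, y)) :=
      hts.prodMk_nhds tendsto_const_nhds
    exact hc.tendsto.comp h2
  -- the limit statement
  have hslice : ∀ t₀ ∈ Ioo ap bp, ContDiffOn ℝ (∞ : ℕ∞ω) (V t₀) (ball x₀ ρ) ∧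
      ∃ ts : ℕ → ℝ, (∀ j, Good (ts j)) ∧ Tendsto ts atTop (𝓝 t₀) ∧
        ∀ i, ∀ y ∈ ball x₀ ρ, Tendsto (fun j => iteratedFDeriv ℝ i (V (ts j)) y) atTop
          (𝓝 (iteratedFDeriv ℝ i (V t₀) y)) := by
    intro t₀ ht₀
    obtain ⟨ts, hgood, hts⟩ := hdense t₀ ht₀
    have hcauchy : CauchySeq ts := hts.cauchySeq
    have hC : ∀ i : ℕ, ∀ y ∈ ball x₀ ρ, ∃ O ∈ 𝓝 y,
        UniformCauchySeqOn (fun j => iteratedFDeriv ℝ i (V (ts j))) atTop O := by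
      intro i y hy
      refine ⟨ball x₀ ρ, isOpen_ball.mem_nhds hy, ?_⟩
      rw [Metric.uniformCauchySeqOn_iff]
      intro e he
      -- a scale `θ` with `E i θ^{κ_i} < e`
      have hev : ∀ᶠ θ in 𝓝[>] (0 : ℝ), 0 < θ ∧ θ < δ' ∧ E i * θ ^ κr i < e := by
        have h1 : ∀ᶠ θ in 𝓝[>] (0 : ℝ), 0 < θ := eventually_mem_nhdsWithin
        have h2 : ∀ᶠ θ in 𝓝 (0 : ℝ), θ < δ' := eventually_lt_nhds hδ'0
        have h3 : Tendsto (fun θ : ℝ => E i * θ ^ κr i) (𝓝 0) (𝓝 0) := by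
          have := (tendsto_id.rpow_const_nhds_zero (hκr0 i)).const_mul (E i)
          simpa using this
        have h4 : ∀ᶠ θ in 𝓝 (0 : ℝ), E i * θ ^ κr i < e := h3.eventually_lt_const he
        exact h1.and ((h2.and h4).filter_mono nhdsWithin_le_nhds)
      obtain ⟨θ, hθ0, hθδ, hθe⟩ := hev.exists
      obtain ⟨N, hN⟩ := Metric.cauchySeq_iff.1 hcauchy θ hθ0
      refine ⟨N, fun j hj l hl z hz => ?_⟩
      rw [dist_eq_norm]
      have hjl : dist (ts j) (ts l) < θ := hN j hj l hl
      calc ‖iteratedFDeriv ℝ i (V (ts j)) z - iteratedFDeriv ℝ i (V (ts l)) z‖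
          ≤ E i * dist (ts j) (ts l) ^ κr i :=
            hmod i (ts j) (ts l) (hgood j) (hgood l) (hjl.trans hθδ) z hz
        _ ≤ E i * θ ^ κr i := by
            refine mul_le_mul_of_nonneg_left ?_ (hE0 i)
            exact Real.rpow_le_rpow dist_nonneg hjl.le (hκr0 i).le
        _ < e := hθe
    have hlim := FunctionSpaces.contDiffOn_infty_of_uniformCauchySeqOn_iteratedFDeriv isOpen_ball
      (fun j => ((hgood j).2.1).mono (ball_subset_ball hρρ₁.le))
      (fun y hy => hptw t₀ ht₀ ts hts y (ball_subset_ball hρρ₁.le hy)) hC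
    exact ⟨hlim.1, ts, hgood, hts, fun i y hy => (hlim.2 i).tendsto_at hy⟩
  /- ── Step 5: bounds, modulus and spatial Lipschitz bounds on every slice ── -/
  have hbound : ∀ n, ∀ t ∈ Ioo ap bp, ∀ y ∈ ball x₀ ρ, ‖iteratedFDeriv ℝ n (V t) y‖ ≤ D n := by
    intro n t ht y hy
    obtain ⟨-, ts, hgood, -, hconv⟩ := hslice t ht
    refine le_of_tendsto ((continuous_norm.tendsto _).comp (hconv n y hy))
      (Eventually.of_forall fun j => ?_)
    exact (hgood j).2.2 n y (ball_subset_ball hρρ₁.le hy)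
  have hmod' : ∀ n, ∀ t ∈ Ioo ap bp, ∀ t' ∈ Ioo ap bp, dist t t' < δ' → ∀ y ∈ ball x₀ ρ,
      ‖iteratedFDeriv ℝ n (V t) y - iteratedFDeriv ℝ n (V t') y‖ ≤ E n * dist t t' ^ κr n := by
    intro n t ht t' ht' hdt y hy
    obtain ⟨-, ts, hgood, hts, hconv⟩ := hslice t ht
    obtain ⟨-, ts', hgood', hts', hconv'⟩ := hslice t' ht'
    have hd : Tendsto (fun j => dist (ts j) (ts' j)) atTop (𝓝 (dist t t')) := hts.dist hts'
    have hev : ∀ᶠ j in atTop,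
        ‖iteratedFDeriv ℝ n (V (ts j)) y - iteratedFDeriv ℝ n (V (ts' j)) y‖ ≤
          E n * dist (ts j) (ts' j) ^ κr n := by
      filter_upwards [hd.eventually_lt_const hdt] with j hj
      exact hmod n (ts j) (ts' j) (hgood j) (hgood' j) hj y hy
    refine le_of_tendsto_of_tendsto ?_ ?_ hev
    · exact (continuous_norm.tendsto _).comp ((hconv n y hy).sub (hconv' n y hy))
    · exact (hd.rpow_const (Or.inr (hκr0 n).le)).const_mul (E n)
  have hlip : ∀ n, ∀ t ∈ Ioo ap bp, ∀ y₁ ∈ ball x₀ ρ, ∀ y₂ ∈ ball x₀ ρ,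
      ‖iteratedFDeriv ℝ n (V t) y₁ - iteratedFDeriv ℝ n (V t) y₂‖ ≤ D (n + 1) * ‖y₁ - y₂‖ := by
    intro n t ht y₁ hy₁ y₂ hy₂
    obtain ⟨hsm, -⟩ := hslice t ht
    have hdiff : ∀ z ∈ ball x₀ ρ, DifferentiableAt ℝ (iteratedFDeriv ℝ n (V t)) z := fun z hz =>
      (hsm.contDiffAt (isOpen_ball.mem_nhds hz)).differentiableAt_iteratedFDeriv
        (natCast_lt_infty n)
    refine (convex_ball x₀ ρ).norm_image_sub_le_of_norm_fderiv_le (fun z hz => hdiff z hz)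
      (fun z hz => ?_) hy₂ hy₁
    rw [norm_fderiv_iteratedFDeriv]
    exact hbound (n + 1) t ht z hz
  /- ── Step 6: the conclusion ── -/
  refine ⟨V, ?_, hV₀c.mono hQsub, fun t ht => (hslice t (hIsub ht)).1,
    fun n w hw => hbound n w.1 (hIsub (mem_prod.1 hw).1) w.2 (mem_prod.1 hw).2, fun n => ?_⟩
  · -- `u = V` a.e. on `Q`
    have : uncurry u =ᵐ[volume.restrict (Ioo a b ×ˢ ball x₀ ρ)] V₀ :=
      ae_restrict_of_ae_restrict_of_subset hQsub huV₀
    exact this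
  · -- the Hölder bound for the sup product metric
    refine SliceTimeHolder.holderOnWith_of_norm_sub_le fun w₁ hw₁ w₂ hw₂ => ?_
    obtain ⟨hs₁, hy₁⟩ := mem_prod.1 hw₁
    obtain ⟨hs₂, hy₂⟩ := mem_prod.1 hw₂
    have hs₁' := hIsub hs₁
    have hs₂' := hIsub hs₂
    rw [Real.coe_toNNReal _ (hCr0 n), hαnκ]
    set d : ℝ := dist w₁ w₂ with hd
    have hd0 : 0 ≤ d := dist_nonneg
    have hdt : dist w₁.1 w₂.1 ≤ d := by rw [hd, Prod.dist_eq]; exact le_max_left _ _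
    have hdx : dist w₁.2 w₂.2 ≤ d := by rw [hd, Prod.dist_eq]; exact le_max_right _ _
    have hdΔ : d ≤ Δ := by
      rw [hd, Prod.dist_eq]
      refine max_le ?_ ?_
      · refine le_trans ?_ ((le_max_left _ _).trans (le_max_right _ _))
        rw [Real.dist_eq]
        exact abs_sub_le_iff.2 ⟨by linarith [hs₁'.2, hs₂'.1], by linarith [hs₁'.1, hs₂'.2]⟩
      · refine le_trans ?_ ((le_max_right _ _).trans (le_max_right _ _))
        rw [mem_ball] at hy₁ hy₂
        have := dist_triangle w₁.2 x₀ w₂.2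
        rw [dist_comm x₀] at this
        linarith
    have hdk0 : 0 ≤ d ^ κr n := Real.rpow_nonneg hd0 _
    -- the spatial increment
    have hT1 : ‖iteratedFDeriv ℝ n (V w₁.1) w₁.2 - iteratedFDeriv ℝ n (V w₁.1) w₂.2‖ ≤
        D (n + 1) * Δ * d ^ κr n := by
      refine (hlip n w₁.1 hs₁' w₁.2 hy₁ w₂.2 hy₂).trans ?_
      rw [← dist_eq_norm, mul_assoc]
      refine mul_le_mul_of_nonneg_left (hdx.trans ?_) (hD (n + 1))
      exact le_mul_rpow_of_le hd0 hdΔ hΔ1 (hκr0 n) (hκr1 n)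
    -- the temporal increment
    have hT2 : ‖iteratedFDeriv ℝ n (V w₁.1) w₂.2 - iteratedFDeriv ℝ n (V w₂.1) w₂.2‖ ≤
        (E n + 2 * D n / δ') * d ^ κr n := by
      rcases lt_or_ge (dist w₁.1 w₂.1) δ' with hlt | hge
      · calc ‖iteratedFDeriv ℝ n (V w₁.1) w₂.2 - iteratedFDeriv ℝ n (V w₂.1) w₂.2‖
            ≤ E n * dist w₁.1 w₂.1 ^ κr n := hmod' n w₁.1 hs₁' w₂.1 hs₂' hlt w₂.2 hy₂
          _ ≤ E n * d ^ κr n :=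
              mul_le_mul_of_nonneg_left (Real.rpow_le_rpow dist_nonneg hdt (hκr0 n).le) (hE0 n)
          _ ≤ (E n + 2 * D n / δ') * d ^ κr n := by
              refine mul_le_mul_of_nonneg_right ?_ hdk0
              have := hD n
              have : 0 ≤ 2 * D n / δ' := by positivity
              linarith
      · have hδd : δ' ≤ d ^ κr n :=
          le_rpow_of_le_of_le_one hδ'1 (hge.trans hdt) hδ'0 (hκr0 n) (hκr1 n)
        calc ‖iteratedFDeriv ℝ n (V w₁.1) w₂.2 - iteratedFDeriv ℝ n (V w₂.1) w₂.2‖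
            ≤ ‖iteratedFDeriv ℝ n (V w₁.1) w₂.2‖ + ‖iteratedFDeriv ℝ n (V w₂.1) w₂.2‖ :=
              norm_sub_le _ _
          _ ≤ 2 * D n := by
              linarith [hbound n w₁.1 hs₁' w₂.2 hy₂, hbound n w₂.1 hs₂' w₂.2 hy₂]
          _ = (2 * D n / δ') * δ' := by field_simp
          _ ≤ (2 * D n / δ') * d ^ κr n :=
              mul_le_mul_of_nonneg_left hδd (by have := hD n; positivity)
          _ ≤ (E n + 2 * D n / δ') * d ^ κr n := by
              refine mul_le_mul_of_nonneg_right ?_ hdk0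
              linarith [hE0 n]
    calc ‖iteratedFDeriv ℝ n (V w₁.1) w₁.2 - iteratedFDeriv ℝ n (V w₂.1) w₂.2‖
        ≤ ‖iteratedFDeriv ℝ n (V w₁.1) w₁.2 - iteratedFDeriv ℝ n (V w₁.1) w₂.2‖ +
            ‖iteratedFDeriv ℝ n (V w₁.1) w₂.2 - iteratedFDeriv ℝ n (V w₂.1) w₂.2‖ :=
          norm_sub_le_norm_sub_add_norm_sub _ _ _
      _ ≤ D (n + 1) * Δ * d ^ κr n + (E n + 2 * D n / δ') * d ^ κr n := add_le_add hT1 hT2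
      _ = Cr n * d ^ κr n := by simp only [hCr]; ring

end Main

end STAssembly

end Literature.Analysis.FluidPDE
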